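import Literature.AlgebraicGeometry.HodgeTheory.CyclicCoverEigenHodgeNumbers
import Literature.AlgebraicGeometry.HodgeTheory.CyclicCoverFormNonsingular
import Literature.AlgebraicGeometry.HodgeTheory.DworkSexticReflectionTransfer
import Literature.AlgebraicGeometry.HodgeTheory.ComplexPointsLocallyContractible
import Literature.AlgebraicGeometry.HodgeTheory.BettiProjectiveSpaceHodgeTate
import Literature.AlgebraicTopology.SingularHomology.SemiFreeQuotientTransfer
import Mathlib.Data.ZMod.QuotientGroup
import HarnessLib

/-!
# The covering group of the cyclic cover `x₃^p = f(x₀,x₁,x₂)` of the plane has a LINE of invariants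
# in `H²` — `carlsonToledo1999_finrank_eigenspace_deck_one` PROVED by the transfer

Family `hodge`, layer `Literature/AlgebraicGeometry/HodgeTheory`. The tree's named fact
`carlsonToledo1999_finrank_eigenspace_deck_one` (file `CyclicCoverEigenHodgeNumbers`; Carlson–Toledo
1999 §2: "`H² = ℂ·h ⊕ H²_0`", "`H^{n+1}(Y)_0 = ⊕_{μ ≠ 1} H(μ)`" — the covering group of the cyclic cover
`X_F = V₊(x₃^p − f) → ℙ²` has exactly a line of invariants in `H²(X_F(ℂ); ℚ)`) was so far a theorem
only MODULO Griffiths' residue description of the Hodge filtration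
(`Summits/…/CyclicUnitaryPowersDeckHodgeOfGriffiths`: the invariant eigen-Hodge numbers are
`(0, 1, 0)`). Here it is proved UNCONDITIONALLY and topologically, as the docstring of the fact says
("transfer: `H²(X_F;ℚ)^{μ_p} = H²(ℙ²;ℚ)`"):

* the covering group `μ_p = ⟨σ⟩`, `σ = g_a : [x] ↦ [a • x]`, `a = (1,1,1,ζ_p)` (`deckUnit`, `diagonalMap`),
  acts on the compact Hausdorff space `X_F(ℂ)`; the coordinate projection
  `q : X_F(ℂ) → ℙ²(ℂ)`, `[x₀:x₁:x₂:x₃] ↦ [x₀:x₁:x₂]` (well defined: `x₃^p = f(x₀,x₁,x₂)` and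
  `f(0) = 0` force `(x₀,x₁,x₂) ≠ 0`) is continuous (`exists_deckProjection`, through the quotient
  topology of `ℙ(ℂ⁴)`), surjective (`ℂ` is algebraically closed), and its fibres are exactly the
  `μ_p`-orbits (two points over `[x₀:x₁:x₂]` differ by a `p`-th root of unity in the last coordinate);
* the action is SEMI-FREE: the fixed locus of every `σ^i ≠ 1` is the branch curve
  `B = X_F ∩ {x₃ = 0}`, the set of complex points of a Zariski-closed subset, hence locally
  contractible (`locallyContractibleSpace_complexPoints`, semialgebraic triangulation) and taut in the
  compact manifold `X_F(ℂ)` (`nonempty_retractionNhds_of_isSmoothProjective`), with taut image in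
  `ℙ²(ℂ)`;
* so Bredon's theorem II.19.2 in the tree's proved form for semi-free actions with taut fixed locus
  (`OrbitMap.transfer_of_semifree`, file `AlgebraicTopology/SingularHomology/SemiFreeQuotientTransfer`)
  gives `q^* : H²(ℙ²(ℂ); ℚ) ↪ H²(X_F(ℂ); ℚ)` with image the `μ_p`-invariants `= ker(σ^* − 1)`, and
  `b₂(ℙ²) = 1` (`finrank_bettiCohomology_projectiveSpace_two_mul`).

Main results: `exists_deckProjection` (the projection with its four properties),
`diagonalMap_pow_eq_self_of_rep_last_eq_zero` / `deckUnit_pow_eq_one_of_diagonalMap_pow_eq_self`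
(fixed points of the powers of the deck transformation), and
**`carlsonToledo1999_finrank_eigenspace_deck_one_holds`**. Everything is proved; no definitions, no
named facts. Written by the prover seat `hodge-nonav-prover-Bx` (g7) for crux K1
`VeryGeneralDeckCommutatorsInHg` (stmt-HodgeConjecture-19544) of route `CyclicUnitaryPowers`, whose
registered binder `stub_ct99InvariantLine` is this fact.

## References

* [CarlsonToledo1999] J. A. Carlson, D. Toledo, Discriminant complements and kernels of monodromy
  representations, Duke Math. J. 97 (1999), §2 (held text p0005).
* [Bredon1997] G. E. Bredon, *Sheaf Theory*, 2nd ed., GTM 170 (1997), II Thm. 19.2.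
* [HatcherAT2002] A. Hatcher, *Algebraic Topology*, CUP 2002, Thm. 3.19 (cohomology of `ℂℙⁿ`),
  §3.G Prop. 3G.1 (transfer).
-/

noncomputable section

open CategoryTheory AlgebraicGeometry MvPolynomial Set Function
open scoped LinearAlgebra.Projectivization
open Literature.AlgebraicGeometry.Motives Literature.AlgebraicTopology.SingularHomology
open Literature.NumberTheory.Transcendental

namespace Literature.AlgebraicGeometry.HodgeTheory

section HodgeTheory

variable {p : ℕ} {f : MvPolynomial (Fin 3) ℂ}

/-! ### §1 Coordinates: the cyclic cover form, the deck unit and its powers -/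

/-- `F(z) = z₃^p − f(z₀,z₁,z₂)` for the cyclic cover form `F = x₃^p − f`.
[cite: CarlsonToledo1999, §2 (universalcyclic) (held text p0004)] -/
theorem eval_cyclicCoverForm_eq (z : Fin 4 → ℂ) :
    MvPolynomial.eval z (cyclicCoverForm p f) = z (Fin.last 3) ^ p - MvPolynomial.eval (Fin.init z) f := by
  conv_lhs => rw [← Fin.snoc_init_self z]
  exact CyclicCoverFormNonsingular.eval_snoc_cyclicCoverForm_eq (Fin.init z) (z (Fin.last 3))

/-- On the cone over `X_F` the first three coordinates never vanish simultaneously: if `z ≠ 0` and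
`F(z) = 0` then `(z₀,z₁,z₂) ≠ 0` (`f` homogeneous of degree `p ≥ 1`, so `f(0) = 0` and `z₃^p = 0`).
[cite: CarlsonToledo1999, §2 (held text p0004)] -/
theorem init_ne_zero_of_eval_cyclicCoverForm_eq_zero (hp : p ≠ 0) (hf : f.IsHomogeneous p)
    {z : Fin 4 → ℂ} (hz : z ≠ 0) (hFz : MvPolynomial.eval z (cyclicCoverForm p f) = 0) :
    Fin.init z ≠ 0 := by
  intro h0
  rw [eval_cyclicCoverForm_eq, h0] at hFz
  have hf0 : MvPolynomial.eval (0 : Fin 3 → ℂ) f = 0 := by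
    have h := Projectivization.eval_smul_of_isHomogeneous hf (0 : ℂ) (0 : Fin 3 → ℂ)
    rwa [zero_smul, zero_pow hp, zero_mul] at h
  rw [hf0, sub_zero] at hFz
  have h3 : z (Fin.last 3) = 0 := pow_eq_zero_iff hp |>.mp hFz
  apply hz
  funext i
  induction i using Fin.lastCases with
  | last => exact h3
  | cast j => exact congrFun h0 j

/-- The deck unit is `1` in the first three coordinates (`σ: y ↦ ζ y` fixes `x₀, x₁, x₂`).
[cite: CarlsonToledo1999, §5 (held text p0011)] -/
theorem deckUnit_apply_castSucc (p : ℕ) (j : Fin 3) : deckUnit p (Fin.castSucc j) = 1 := by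
  have h : Fin.castSucc j ≠ Fin.last 3 := (Fin.castSucc_lt_last j).ne
  unfold deckUnit
  rw [if_neg h]

/-- The deck unit is `ζ_p = exp(2πi/p)` in the last coordinate ("`y ∘ σ = ζ y`, `ζ = e^{2πi/k}`").
[cite: CarlsonToledo1999, §5 (held text p0011)] -/
theorem val_deckUnit_apply_last (p : ℕ) :
    ((deckUnit p (Fin.last 3) : ℂˣ) : ℂ) = Complex.exp (2 * (Real.pi : ℂ) * Complex.I / (p : ℂ)) := by
  simp [deckUnit]

/-- `a^n` is `1` in the first three coordinates. [cite: CarlsonToledo1999, §5 (held text p0011)] -/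
theorem deckUnit_pow_apply_castSucc (p n : ℕ) (j : Fin 3) : (deckUnit p ^ n) (Fin.castSucc j) = 1 := by
  rw [Pi.pow_apply, deckUnit_apply_castSucc, one_pow]

/-- `a^n` is `ζ_p^n` in the last coordinate. [cite: CarlsonToledo1999, §5 (held text p0011)] -/
theorem val_deckUnit_pow_apply_last (p n : ℕ) :
    (((deckUnit p ^ n) (Fin.last 3) : ℂˣ) : ℂ) = Complex.exp (2 * (Real.pi : ℂ) * Complex.I / (p : ℂ)) ^ n := by
  rw [Pi.pow_apply, Units.val_pow_eq_pow_val, val_deckUnit_apply_last]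

/-- `a^n • z` has the same first three coordinates as `z`. [cite: CarlsonToledo1999, §5 (held text p0011)] -/
theorem init_deckUnit_pow_smul (p n : ℕ) (z : Fin 4 → ℂ) : Fin.init ((deckUnit p ^ n) • z) = Fin.init z := by
  funext j
  change ((deckUnit p ^ n) • z) (Fin.castSucc j) = z (Fin.castSucc j)
  rw [smul_apply_eq_mul, deckUnit_pow_apply_castSucc, Units.val_one, one_mul]

/-- The last coordinate of `a^n • z` is `ζ_p^n z₃`. [cite: CarlsonToledo1999, §5 (held text p0011)] -/
theorem deckUnit_pow_smul_apply_last (p n : ℕ) (z : Fin 4 → ℂ) :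
    ((deckUnit p ^ n) • z) (Fin.last 3) = Complex.exp (2 * (Real.pi : ℂ) * Complex.I / (p : ℂ)) ^ n * z (Fin.last 3) := by
  rw [smul_apply_eq_mul, val_deckUnit_pow_apply_last]

/-- `a^p = 1`: the deck unit has finite order (`ζ^k = 1`). [cite: CarlsonToledo1999, §5 (held text p0011)] -/
theorem deckUnit_pow_self (hp : p ≠ 0) : deckUnit p ^ p = 1 := by
  funext i
  rw [Pi.pow_apply, Pi.one_apply]
  apply Units.ext
  rw [Units.val_pow_eq_pow_val, Units.val_one]
  induction i using Fin.lastCases with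
  | last => rw [val_deckUnit_apply_last]; exact (Complex.isPrimitiveRoot_exp p hp).pow_eq_one
  | cast j => rw [deckUnit_apply_castSucc, Units.val_one, one_pow]

/-- The deck unit has finite order. [cite: CarlsonToledo1999, §5 (held text p0011)] -/
theorem isOfFinOrder_deckUnit (hp : p ≠ 0) : IsOfFinOrder (deckUnit p) :=
  isOfFinOrder_iff_pow_eq_one.mpr ⟨p, Nat.pos_of_ne_zero hp, deckUnit_pow_self hp⟩

/-- Every element of the cyclic covering group `⟨a⟩` is a natural power of `a`.
[cite: CarlsonToledo1999, §5 (held text p0011)] -/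
theorem exists_pow_eq_of_mem_zpowers_deckUnit (hp : p ≠ 0) {g : Fin 4 → ℂˣ}
    (hg : g ∈ Subgroup.zpowers (deckUnit p)) : ∃ n : ℕ, deckUnit p ^ n = g := by
  rw [← (isOfFinOrder_deckUnit hp).mem_powers_iff_mem_zpowers, Submonoid.mem_powers_iff] at hg
  exact hg

/-- `a^n = 1` as soon as its last coordinate is `1`. [cite: CarlsonToledo1999, §5 (held text p0011)] -/
theorem deckUnit_pow_eq_one_of_apply_last (p n : ℕ) (h : ((deckUnit p ^ n) (Fin.last 3) : ℂ) = 1) :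
    deckUnit p ^ n = 1 := by
  funext i
  induction i using Fin.lastCases with
  | last => exact Units.ext (by rw [h, Pi.one_apply, Units.val_one])
  | cast j => rw [deckUnit_pow_apply_castSucc, Pi.one_apply]

/-! ### §2 Powers of the deck transformation on complex points -/

section Deck

variable (F : MvPolynomial (Fin 4) ℂ) {a b : Fin 4 → ℂˣ}

/-- `g_a` depends only on `a` (transport along an equality `a = b`; a private copy of the tree's
`diagonalMap_congr` of `FermatSubvariety`, not imported to keep the import cone small). [cite: Katz2009, §3] -/
private theorem diagonalMap_congr_of_eq (h : a = b) (ha : a ∈ diagonalStabilizer F) (hb : b ∈ diagonalStabilizer F) :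
    diagonalMap F ha = diagonalMap F hb := by
  subst h; rfl

/-- `g_{a^{n+1}} = g_{a^n} ∘ g_a` (the action is a group action). [cite: Katz2009, §3] -/
theorem diagonalMap_pow_succ (ha : a ∈ diagonalStabilizer F) (n : ℕ) :
    diagonalMap F (pow_mem ha (n + 1)) = (diagonalMap F (pow_mem ha n)).comp (diagonalMap F ha) := by
  rw [diagonalMap_congr_of_eq F (pow_succ a n) (pow_mem ha (n + 1)) (mul_mem (pow_mem ha n) ha), diagonalMap_mul]

/-- **`(g_{a^n})^* = ((g_a)^*)ⁿ` on `Hᵏ(X_F(ℂ); R)`.** [cite: HatcherAT2002, §3.1 p. 199] -/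
theorem hom_map_diagonalMap_pow (R : Type) [CommRing R] (ha : a ∈ diagonalStabilizer F) (n k : ℕ) :
    (singularCohomology.map R R (diagonalMap F (pow_mem ha n)) k).hom =
      (singularCohomology.map R R (diagonalMap F ha) k).hom ^ n := by
  induction n with
  | zero =>
    rw [diagonalMap_congr_of_eq F (pow_zero a) (pow_mem ha 0) (one_mem _), diagonalMap_one,
      singularCohomology.map_id, pow_zero, Module.End.one_eq_id]
    rfl
  | succ n ih =>
    rw [diagonalMap_pow_succ, singularCohomology.map_comp, ModuleCat.hom_comp, ih, pow_succ', Module.End.mul_eq_comp]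

/-- A class fixed by `g_a^*` is fixed by every `g_{a^n}^*`. [cite: HatcherAT2002, §3.1 p. 199] -/
theorem map_diagonalMap_pow_eq_self (R : Type) [CommRing R] (ha : a ∈ diagonalStabilizer F) (n k : ℕ)
    {c : singularCohomology R R (ComplexPoints (SmoothHypersurface.hypersurface F)) k}
    (hc : singularCohomology.map R R (diagonalMap F ha) k c = c) :
    singularCohomology.map R R (diagonalMap F (pow_mem ha n)) k c = c := by
  change (singularCohomology.map R R (diagonalMap F (pow_mem ha n)) k).hom c = c
  rw [hom_map_diagonalMap_pow]
  induction n with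
  | zero => rw [pow_zero, Module.End.one_apply]
  | succ n ih => rw [pow_succ, Module.End.mul_apply]; exact (congrArg _ hc).trans ih

end Deck

/-! ### §3 Fixed points of the powers of the deck transformation -/

section Fixed

variable (hp : p ≠ 0) (f)

/-- The homogeneous coordinates `z` of a complex point of `X_F` satisfy `F(z) = 0`.
[cite: SerreGAGA1956, §2 n°5] -/
theorem eval_rep_cyclicCoverForm_eq_zero (hf : f.IsHomogeneous p)
    (x : ComplexPoints (SmoothHypersurface.hypersurface (cyclicCoverForm p f))) :
    MvPolynomial.eval (hypersurfacePoint (SmoothHypersurface.hypersurfaceι (cyclicCoverForm p f)) x).rep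
      (cyclicCoverForm p f) = 0 :=
  hypersurfacePoint_mem_projZeroLocus
    (CyclicCoverFormNonsingular.isHomogeneous_cyclicCoverForm_of_isHomogeneous hf)
    (SmoothHypersurface.range_hypersurfaceι _) x _ (Set.mem_singleton _)

include hp in
/-- The first three homogeneous coordinates of a complex point of `X_F` do not all vanish (the vertex
`[0:0:0:1]` of the projection is not on `X_F`). [cite: CarlsonToledo1999, §2 (held text p0004)] -/
theorem init_rep_ne_zero (hf : f.IsHomogeneous p)
    (x : ComplexPoints (SmoothHypersurface.hypersurface (cyclicCoverForm p f))) :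
    Fin.init (hypersurfacePoint (SmoothHypersurface.hypersurfaceι (cyclicCoverForm p f)) x).rep ≠ 0 :=
  init_ne_zero_of_eval_cyclicCoverForm_eq_zero hp hf (Projectivization.rep_nonzero _)
    (eval_rep_cyclicCoverForm_eq_zero f hf x)

/-- **Points over the branch curve are fixed**: if `z₃ = 0` then `g_{a^n} x = x` (the coordinates
`a^n • z = z` agree). [cite: CarlsonToledo1999, §2 (held text p0005)] -/
theorem diagonalMap_pow_eq_self_of_rep_last_eq_zero
    (ha : deckUnit p ∈ diagonalStabilizer (cyclicCoverForm p f)) (n : ℕ)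
    (x : ComplexPoints (SmoothHypersurface.hypersurface (cyclicCoverForm p f)))
    (hx : (hypersurfacePoint (SmoothHypersurface.hypersurfaceι (cyclicCoverForm p f)) x).rep (Fin.last 3) = 0) :
    diagonalMap (cyclicCoverForm p f) (pow_mem ha n) x = x := by
  apply (isEmbedding_hypersurfacePoint (SmoothHypersurface.hypersurfaceι (cyclicCoverForm p f))).injective
  rw [hypersurfacePoint_diagonalMap, ← Projectivization.mk_rep
    (hypersurfacePoint (SmoothHypersurface.hypersurfaceι (cyclicCoverForm p f)) x)]
  congr 1
  · funext i
    induction i using Fin.lastCases with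
    | last => rw [deckUnit_pow_smul_apply_last, Projectivization.mk_rep, hx, mul_zero]
    | cast j =>
      rw [Projectivization.mk_rep]
      exact congrFun (init_deckUnit_pow_smul p n _) j

include hp in
/-- **Off the branch curve only the identity has fixed points**: if `z₃ ≠ 0` and `g_{a^n} x = x`
then `a^n = 1` (comparing `a^n • z = t • z` at a non-zero coordinate among `z₀, z₁, z₂` gives
`t = 1`, then `ζ^n z₃ = z₃`). [cite: CarlsonToledo1999, §2 (held text p0005)] -/
theorem deckUnit_pow_eq_one_of_diagonalMap_pow_eq_self (hf : f.IsHomogeneous p)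
    (ha : deckUnit p ∈ diagonalStabilizer (cyclicCoverForm p f)) (n : ℕ)
    (x : ComplexPoints (SmoothHypersurface.hypersurface (cyclicCoverForm p f)))
    (hx : (hypersurfacePoint (SmoothHypersurface.hypersurfaceι (cyclicCoverForm p f)) x).rep (Fin.last 3) ≠ 0)
    (hfix : diagonalMap (cyclicCoverForm p f) (pow_mem ha n) x = x) :
    deckUnit p ^ n = 1 := by
  have hmk : Projectivization.mk ℂ ((deckUnit p ^ n) •
      (hypersurfacePoint (SmoothHypersurface.hypersurfaceι (cyclicCoverForm p f)) x).rep)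
      ((smul_ne_zero_iff_ne _).mpr (Projectivization.rep_nonzero _)) =
      Projectivization.mk ℂ (hypersurfacePoint (SmoothHypersurface.hypersurfaceι (cyclicCoverForm p f)) x).rep
      (Projectivization.rep_nonzero _) := by
    rw [← hypersurfacePoint_diagonalMap (cyclicCoverForm p f) (pow_mem ha n) x, hfix, Projectivization.mk_rep]
  rw [Projectivization.mk_eq_mk_iff'] at hmk
  obtain ⟨t, ht⟩ := hmk
  -- a non-zero coordinate among the first three
  obtain ⟨j, hj⟩ : ∃ j : Fin 3,
      Fin.init (hypersurfacePoint (SmoothHypersurface.hypersurfaceι (cyclicCoverForm p f)) x).rep j ≠ 0 :=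
    Function.ne_iff.mp (init_rep_ne_zero f hp hf x)
  have ht1 : t = 1 := by
    have h := congrFun ht (Fin.castSucc j)
    rw [Pi.smul_apply, smul_eq_mul, smul_apply_eq_mul, deckUnit_pow_apply_castSucc, Units.val_one, one_mul] at h
    exact (mul_eq_right₀ hj).mp h
  have h3 := congrFun ht (Fin.last 3)
  rw [ht1, one_smul, deckUnit_pow_smul_apply_last] at h3
  exact deckUnit_pow_eq_one_of_apply_last p n ((mul_eq_right₀ hx).mp h3.symm)

end Fixed

/-! ### §4 The projection `X_F(ℂ) → ℙ²(ℂ)`, `[x₀:x₁:x₂:x₃] ↦ [x₀:x₁:x₂]` -/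

section Projection

/-- **The coordinate projection `ℙ(ℂ⁴) ⊃ {(z₀,z₁,z₂) ≠ 0} → ℙ(ℂ³)` is continuous** on its (open)
domain, for the quotient topologies: it lifts to the continuous linear map `z ↦ (z₀,z₁,z₂)` on
representatives, and `ℂ⁴ ∖ 0 → ℙ(ℂ⁴)` restricted over an open set is a quotient map.
[cite: HatcherAT2002, §3.1 p. 199] -/
theorem continuous_initProjection :
    Continuous fun y : ↥({y : ℙ ℂ (Fin 4 → ℂ) | Fin.init y.rep ≠ 0} : Set (ℙ ℂ (Fin 4 → ℂ))) =>
      Projectivization.mk ℂ (Fin.init y.1.rep) y.2 := by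
  set S : Set (ℙ ℂ (Fin 4 → ℂ)) := {y | Fin.init y.rep ≠ 0} with hS
  -- `S` is the complement of the projective zero locus of `x₀, x₁, x₂`, hence open
  have hSeq : S = (Projectivization.projZeroLocus (Set.range fun j : Fin 3 =>
      (MvPolynomial.X (Fin.castSucc j) : MvPolynomial (Fin 4) ℂ)))ᶜ := by
    ext y
    simp only [hS, Set.mem_setOf_eq, Set.mem_compl_iff, Projectivization.projZeroLocus, Set.mem_range,
      forall_exists_index, forall_apply_eq_imp_iff, MvPolynomial.eval_X, ne_eq, funext_iff, Fin.init,
      Pi.zero_apply, not_forall]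
  have hSo : IsOpen S := by
    rw [hSeq, isOpen_compl_iff]
    refine Projectivization.isClosed_projZeroLocus ?_
    rintro _ ⟨j, rfl⟩
    rw [MvPolynomial.totalDegree_X]
    exact MvPolynomial.isHomogeneous_X ℂ _
  -- the restricted quotient map
  have hQ : Topology.IsQuotientMap (S.restrictPreimage
      (fun v : {v : Fin 4 → ℂ // v ≠ 0} ↦ Projectivization.mk ℂ v.1 v.2)) :=
    Projectivization.isQuotientMap_mk.restrictPreimage_isOpen hSo
  rw [hQ.continuous_iff]
  -- on representatives the map is `v ↦ [(v₀,v₁,v₂)]`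
  have hinit : ∀ v : {v : Fin 4 → ℂ // v ≠ 0}, Projectivization.mk ℂ v.1 v.2 ∈ S → Fin.init v.1 ≠ 0 := by
    intro v hv h0
    apply hv
    obtain ⟨c, hc⟩ := Projectivization.exists_smul_eq_mk_rep ℂ v.1 v.2
    rw [← hc]
    funext j
    change (c • v.1) (Fin.castSucc j) = 0
    rw [Pi.smul_apply, show v.1 (Fin.castSucc j) = Fin.init v.1 j from rfl, h0, Pi.zero_apply, smul_zero]
  have heq : (fun y : S => Projectivization.mk ℂ (Fin.init y.1.rep) y.2) ∘
      S.restrictPreimage (fun v : {v : Fin 4 → ℂ // v ≠ 0} ↦ Projectivization.mk ℂ v.1 v.2) =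
      fun v : ↥((fun v : {v : Fin 4 → ℂ // v ≠ 0} ↦ Projectivization.mk ℂ v.1 v.2) ⁻¹' S) =>
        Projectivization.mk ℂ (Fin.init v.1.1) (hinit v.1 v.2) := by
    funext v
    simp only [Function.comp_apply]
    obtain ⟨c, hc⟩ := Projectivization.exists_smul_eq_mk_rep ℂ v.1.1 v.1.2
    rw [Projectivization.mk_eq_mk_iff']
    refine ⟨(c : ℂ), ?_⟩
    funext j
    change (c : ℂ) * v.1.1 (Fin.castSucc j) = (S.restrictPreimage _ v).1.rep (Fin.castSucc j)
    rw [Set.restrictPreimage_coe, ← hc]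
    rfl
  rw [heq]
  have hc1 : Continuous fun v : ↥((fun v : {v : Fin 4 → ℂ // v ≠ 0} ↦ Projectivization.mk ℂ v.1 v.2) ⁻¹' S) =>
      (⟨Fin.init v.1.1, hinit v.1 v.2⟩ : {w : Fin 3 → ℂ // w ≠ 0}) := by
    refine Continuous.subtype_mk ?_ _
    exact (continuous_pi fun j => (continuous_apply (Fin.castSucc j))).comp
      (continuous_subtype_val.comp continuous_subtype_val)
  exact Projectivization.continuous_mk.comp hc1

/-- **The projection of the cyclic cover onto the plane on complex points.** For `p ≥ 1` and `f` a
ternary form of degree `p` there is a continuous map `q : X_F(ℂ) → ℙ²(ℂ)` (to the complex points of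
the tree's `projectiveSpace 2 ℂ`, through the comparison homeomorphism `projPoint`) sending the point
with homogeneous coordinates `[z₀:z₁:z₂:z₃]` to `[z₀:z₁:z₂]`.
[cite: CarlsonToledo1999, §2 (held text p0004)] -/
theorem exists_deckProjection (hp : p ≠ 0) (hf : f.IsHomogeneous p) :
    ∃ q : C(ComplexPoints (SmoothHypersurface.hypersurface (cyclicCoverForm p f)),
        ComplexPoints (projectiveSpace 2 ℂ)),
      ∀ x (h : Fin.init (hypersurfacePoint (SmoothHypersurface.hypersurfaceι (cyclicCoverForm p f)) x).rep ≠ 0),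
        q x = projPoint 2 (Projectivization.mk ℂ
          (Fin.init (hypersurfacePoint (SmoothHypersurface.hypersurfaceι (cyclicCoverForm p f)) x).rep) h) := by
  refine ⟨⟨fun x => projPoint 2 (Projectivization.mk ℂ
      (Fin.init (hypersurfacePoint (SmoothHypersurface.hypersurfaceι (cyclicCoverForm p f)) x).rep)
      (init_rep_ne_zero f hp hf x)), ?_⟩, fun x h => rfl⟩
  refine (continuous_projPoint 2).comp ?_
  exact continuous_initProjection.comp
    ((continuous_hypersurfacePoint _).subtype_mk fun x => init_rep_ne_zero f hp hf x)

end Projection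

/-! ### §5 Fibres of the projection are the deck orbits; surjectivity -/

section Fibres

/-- Membership of `[z]` in the projective zero locus of a homogeneous `F` from `F(z) = 0` (any
representative). [cite: SerreGAGA1956, §2 n°5] -/
theorem mk_mem_projZeroLocus_of_eval_eq_zero {n d : ℕ} {F : MvPolynomial (Fin n) ℂ} (hF : F.IsHomogeneous d)
    {z : Fin n → ℂ} (hz : z ≠ 0) (h : MvPolynomial.eval z F = 0) :
    Projectivization.mk ℂ z hz ∈ Projectivization.projZeroLocus {F} := by
  intro G hG
  rw [Set.mem_singleton_iff] at hG
  subst hG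
  obtain ⟨c, hc⟩ := Projectivization.exists_smul_eq_mk_rep ℂ z hz
  rw [← hc, Units.smul_def, Projectivization.eval_smul_of_isHomogeneous hF, h, mul_zero]

/-- **The projection is constant on deck orbits**: `q (g_{a^n} x) = q x`.
[cite: CarlsonToledo1999, §2 (held text p0005)] -/
theorem deckProjection_diagonalMap_pow (hp : p ≠ 0) (hf : f.IsHomogeneous p)
    {q : C(ComplexPoints (SmoothHypersurface.hypersurface (cyclicCoverForm p f)), ComplexPoints (projectiveSpace 2 ℂ))}
    (hq : ∀ x (h : Fin.init (hypersurfacePoint (SmoothHypersurface.hypersurfaceι (cyclicCoverForm p f)) x).rep ≠ 0),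
        q x = projPoint 2 (Projectivization.mk ℂ
          (Fin.init (hypersurfacePoint (SmoothHypersurface.hypersurfaceι (cyclicCoverForm p f)) x).rep) h))
    (ha : deckUnit p ∈ diagonalStabilizer (cyclicCoverForm p f)) (n : ℕ)
    (x : ComplexPoints (SmoothHypersurface.hypersurface (cyclicCoverForm p f))) :
    q (diagonalMap (cyclicCoverForm p f) (pow_mem ha n) x) = q x := by
  rw [hq _ (init_rep_ne_zero f hp hf _), hq _ (init_rep_ne_zero f hp hf _)]
  congr 1
  obtain ⟨t, ht⟩ := exists_rep_hypersurfacePoint_diagonalMap (cyclicCoverForm p f) (pow_mem ha n) x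
  rw [Projectivization.mk_eq_mk_iff']
  refine ⟨t, ?_⟩
  rw [ht]
  funext j
  simp only [Fin.init, Pi.smul_apply, smul_eq_mul, smul_apply_eq_mul, deckUnit_pow_apply_castSucc,
    Units.val_one, one_mul]

/-- **Two points in one fibre of the projection differ by a deck transformation**: if `q x = q x'`
then `x' = g_{a^n} x` for some `n` (the last coordinates satisfy `z'₃^p = (t z₃)^p`, so
`z'₃ = ζ^n t z₃` for a `p`-th root of unity `ζ^n`). [cite: CarlsonToledo1999, §2 (held text p0005)] -/
theorem exists_diagonalMap_pow_eq_of_deckProjection_eq (hp : p ≠ 0) (hf : f.IsHomogeneous p)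
    {q : C(ComplexPoints (SmoothHypersurface.hypersurface (cyclicCoverForm p f)), ComplexPoints (projectiveSpace 2 ℂ))}
    (hq : ∀ x (h : Fin.init (hypersurfacePoint (SmoothHypersurface.hypersurfaceι (cyclicCoverForm p f)) x).rep ≠ 0),
        q x = projPoint 2 (Projectivization.mk ℂ
          (Fin.init (hypersurfacePoint (SmoothHypersurface.hypersurfaceι (cyclicCoverForm p f)) x).rep) h))
    (ha : deckUnit p ∈ diagonalStabilizer (cyclicCoverForm p f))
    {x x' : ComplexPoints (SmoothHypersurface.hypersurface (cyclicCoverForm p f))} (hxx' : q x = q x') :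
    ∃ n : ℕ, diagonalMap (cyclicCoverForm p f) (pow_mem ha n) x = x' := by
  haveI : NeZero p := ⟨hp⟩
  have hprim : IsPrimitiveRoot (Complex.exp (2 * (Real.pi : ℂ) * Complex.I / (p : ℂ))) p :=
    Complex.isPrimitiveRoot_exp p hp
  rw [hq _ (init_rep_ne_zero f hp hf _), hq _ (init_rep_ne_zero f hp hf _)] at hxx'
  have hmk := projPoint_injective 2 hxx'
  rw [Projectivization.mk_eq_mk_iff'] at hmk
  -- `t • init z' = init z`, `z = rep (pt x)`, `z' = rep (pt x')`
  obtain ⟨t, ht⟩ := hmk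
  -- the equations of the cone: `z₃^p = f(init z)`, `z'₃^p = f(init z')`
  have hFz : (hypersurfacePoint (SmoothHypersurface.hypersurfaceι (cyclicCoverForm p f)) x).rep (Fin.last 3) ^ p =
      MvPolynomial.eval (Fin.init (hypersurfacePoint (SmoothHypersurface.hypersurfaceι (cyclicCoverForm p f)) x).rep) f := by
    have h := eval_rep_cyclicCoverForm_eq_zero f hf x
    rw [eval_cyclicCoverForm_eq, sub_eq_zero] at h
    exact h
  have hFz' : (hypersurfacePoint (SmoothHypersurface.hypersurfaceι (cyclicCoverForm p f)) x').rep (Fin.last 3) ^ p =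
      MvPolynomial.eval (Fin.init (hypersurfacePoint (SmoothHypersurface.hypersurfaceι (cyclicCoverForm p f)) x').rep) f := by
    have h := eval_rep_cyclicCoverForm_eq_zero f hf x'
    rw [eval_cyclicCoverForm_eq, sub_eq_zero] at h
    exact h
  -- `init z = t • init z'` gives `z₃^p = (t z'₃)^p`
  have hpow : (hypersurfacePoint (SmoothHypersurface.hypersurfaceι (cyclicCoverForm p f)) x).rep (Fin.last 3) ^ p =
      (t * (hypersurfacePoint (SmoothHypersurface.hypersurfaceι (cyclicCoverForm p f)) x').rep (Fin.last 3)) ^ p := by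
    rw [hFz, ← ht, Projectivization.eval_smul_of_isHomogeneous hf, mul_pow, hFz']
  -- a `p`-th root of unity relating the last coordinates: `z₃ = ζ^i (t z'₃)`
  obtain ⟨i, hi⟩ : ∃ i : ℕ,
      (hypersurfacePoint (SmoothHypersurface.hypersurfaceι (cyclicCoverForm p f)) x).rep (Fin.last 3) =
        Complex.exp (2 * (Real.pi : ℂ) * Complex.I / (p : ℂ)) ^ i *
          (t * (hypersurfacePoint (SmoothHypersurface.hypersurfaceι (cyclicCoverForm p f)) x').rep (Fin.last 3)) := by
    by_cases h0 : t * (hypersurfacePoint (SmoothHypersurface.hypersurfaceι (cyclicCoverForm p f)) x').rep (Fin.last 3) = 0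
    · refine ⟨0, ?_⟩
      rw [h0, zero_pow hp] at hpow
      rw [pow_zero, one_mul, h0]
      exact (pow_eq_zero_iff hp).mp hpow
    · have hu : ((hypersurfacePoint (SmoothHypersurface.hypersurfaceι (cyclicCoverForm p f)) x).rep (Fin.last 3) /
          (t * (hypersurfacePoint (SmoothHypersurface.hypersurfaceι (cyclicCoverForm p f)) x').rep (Fin.last 3))) ^ p = 1 := by
        rw [div_pow, hpow, div_self (pow_ne_zero _ h0)]
      obtain ⟨i, -, hi⟩ := hprim.eq_pow_of_pow_eq_one hu
      exact ⟨i, by rw [hi, div_mul_cancel₀ _ h0]⟩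
  -- hence `z = t • (a^i • z')`, i.e. `x = g_{a^i} x'`
  have hx : diagonalMap (cyclicCoverForm p f) (pow_mem ha i) x' = x := by
    apply (isEmbedding_hypersurfacePoint (SmoothHypersurface.hypersurfaceι (cyclicCoverForm p f))).injective
    symm
    rw [hypersurfacePoint_diagonalMap, ← Projectivization.mk_rep
      (hypersurfacePoint (SmoothHypersurface.hypersurfaceι (cyclicCoverForm p f)) x),
      Projectivization.mk_eq_mk_iff']
    refine ⟨t, ?_⟩
    funext k
    induction k using Fin.lastCases with
    | last =>
      rw [Pi.smul_apply, smul_eq_mul, deckUnit_pow_smul_apply_last, hi]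
      ring
    | cast j =>
      have h := congrFun ht j
      simp only [Fin.init, Pi.smul_apply, smul_eq_mul] at h
      rw [Pi.smul_apply, smul_eq_mul, smul_apply_eq_mul, deckUnit_pow_apply_castSucc, Units.val_one, one_mul]
      exact h
  -- invert: `a^{i(p-1)} a^i = a^{ip} = 1`, so `x' = g_{a^{i(p-1)}} x`
  refine ⟨i * (p - 1), ?_⟩
  rw [← hx, ← ContinuousMap.comp_apply, ← diagonalMap_mul]
  have h1 : deckUnit p ^ (i * (p - 1)) * deckUnit p ^ i = 1 := by
    rw [← pow_add, show i * (p - 1) + i = p * i by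
      cases p with
      | zero => exact absurd rfl hp
      | succ m => rw [Nat.add_sub_cancel]; ring, pow_mul, deckUnit_pow_self hp, one_pow]
  rw [diagonalMap_congr_of_eq (cyclicCoverForm p f) h1 (mul_mem (pow_mem ha _) (pow_mem ha _)) (one_mem _),
    diagonalMap_one, ContinuousMap.id_apply]

/-- **The projection is surjective** (`ℂ` is algebraically closed: over `[w]` lies `[w : s]` with
`s^p = f(w)`). [cite: CarlsonToledo1999, §2 (held text p0004)] -/
theorem deckProjection_surjective (hp : p ≠ 0) (hf : f.IsHomogeneous p)
    {q : C(ComplexPoints (SmoothHypersurface.hypersurface (cyclicCoverForm p f)), ComplexPoints (projectiveSpace 2 ℂ))}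
    (hq : ∀ x (h : Fin.init (hypersurfacePoint (SmoothHypersurface.hypersurfaceι (cyclicCoverForm p f)) x).rep ≠ 0),
        q x = projPoint 2 (Projectivization.mk ℂ
          (Fin.init (hypersurfacePoint (SmoothHypersurface.hypersurfaceι (cyclicCoverForm p f)) x).rep) h)) :
    Function.Surjective q := by
  intro y
  obtain ⟨y, rfl⟩ := projPoint_surjective 2 y
  induction y using Projectivization.ind with
  | h w hw =>
    obtain ⟨s, hs⟩ := IsAlgClosed.exists_pow_nat_eq (MvPolynomial.eval w f) (Nat.pos_of_ne_zero hp)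
    set z : Fin 4 → ℂ := Fin.snoc w s with hzdef
    have hz : z ≠ 0 := by
      intro h
      apply hw
      funext j
      have hj := congrFun h (Fin.castSucc j)
      rw [hzdef, Fin.snoc_castSucc] at hj
      exact hj
    have hFz : MvPolynomial.eval z (cyclicCoverForm p f) = 0 := by
      rw [hzdef, CyclicCoverFormNonsingular.eval_snoc_cyclicCoverForm_eq, hs, sub_self]
    obtain ⟨x, hx⟩ := exists_hypersurfacePoint_eq
      (CyclicCoverFormNonsingular.isHomogeneous_cyclicCoverForm_of_isHomogeneous hf)
      (SmoothHypersurface.range_hypersurfaceι (cyclicCoverForm p f))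
      (mk_mem_projZeroLocus_of_eval_eq_zero
        (CyclicCoverFormNonsingular.isHomogeneous_cyclicCoverForm_of_isHomogeneous hf) hz hFz)
    refine ⟨x, ?_⟩
    rw [hq _ (init_rep_ne_zero f hp hf _)]
    congr 1
    obtain ⟨c, hc⟩ := Projectivization.exists_smul_eq_mk_rep ℂ z hz
    rw [Projectivization.mk_eq_mk_iff']
    refine ⟨c, ?_⟩
    rw [hx, ← hc]
    funext j
    rw [Units.smul_def, Pi.smul_apply, show Fin.init ((c : ℂ) • z) j = ((c : ℂ) • z) (Fin.castSucc j) from rfl,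
      Pi.smul_apply, hzdef, Fin.snoc_castSucc]

end Fibres

/-! ### §6 The invariant line: `carlsonToledo1999_finrank_eigenspace_deck_one` holds -/

section InvariantLine

/-- **Carlson–Toledo 1999 §2 — the covering group of a cyclic cover of the plane has a line of
invariants in `H²` — PROVED:** for `p ≥ 3`, `f ≠ 0` a ternary form of degree `p` with `X_F = V₊(x₃^p − f)`
smooth projective, `dim_ℚ ker(σ_F^* − 1 | H²(X_F(ℂ); ℚ)) = 1`. Proof: the transfer
`H²(X_F(ℂ); ℚ)^{μ_p} ≅ H²(ℙ²(ℂ); ℚ)` along the projection `q : X_F(ℂ) → ℙ²(ℂ)` (Bredon II.19.2 for the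
semi-free action of `μ_p = ⟨σ_F⟩` with fixed locus the branch curve, `OrbitMap.transfer_of_semifree`), and
`b₂(ℙ²) = 1`. [cite: CarlsonToledo1999, §2 (held text p0005)] [cite: Bredon1997, II Thm. 19.2]
[cite: HatcherAT2002, Thm. 3.19] -/
theorem carlsonToledo1999_finrank_eigenspace_deck_one_holds :
    carlsonToledo1999_finrank_eigenspace_deck_one := by
  intro p hp3 f hf hf0 hX ha
  have hp : p ≠ 0 := by omega
  haveI : NeZero p := ⟨hp⟩
  -- the spaces
  set F := cyclicCoverForm p f with hFdef
  haveI := ComplexPoints.compactSpace_of_isSmoothProjective hX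
  haveI := ComplexPoints.t2Space_of_isSmoothProjective hX
  have hY : IsSmoothProjective 2 (projectiveSpace 2 ℂ) := isSmoothProjective_projectiveSpace' 2
  haveI := ComplexPoints.t2Space_of_isSmoothProjective hY
  -- the group `G = ⟨a⟩ ≤ (ℂˣ)⁴` and its action through `g_b`, `b ∈ G`
  have hle : Subgroup.zpowers (deckUnit p) ≤ diagonalStabilizer F := Subgroup.zpowers_le.mpr ha
  haveI : Finite ↥(Subgroup.zpowers (deckUnit p)) := (isOfFinOrder_deckUnit hp).finite_zpowers.to_subtype
  letI : Fintype ↥(Subgroup.zpowers (deckUnit p)) := Fintype.ofFinite _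
  letI act : MulAction ↥(Subgroup.zpowers (deckUnit p)) (ComplexPoints (SmoothHypersurface.hypersurface F)) :=
    { smul := fun g x => diagonalMap F (hle g.2) x
      one_smul := fun x => by
        change diagonalMap F (one_mem (diagonalStabilizer F)) x = x
        rw [diagonalMap_one]; rfl
      mul_smul := fun g h x => by
        change diagonalMap F (mul_mem (hle g.2) (hle h.2)) x = diagonalMap F (hle g.2) (diagonalMap F (hle h.2) x)
        rw [diagonalMap_mul]; rfl }
  haveI : ContinuousConstSMul ↥(Subgroup.zpowers (deckUnit p)) (ComplexPoints (SmoothHypersurface.hypersurface F)) :=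
    ⟨fun g => (diagonalMap F (hle g.2)).continuous⟩
  -- every group element acts as some `g_{a^n}`
  have hact : ∀ g : ↥(Subgroup.zpowers (deckUnit p)), ∃ n : ℕ, ∀ x : ComplexPoints (SmoothHypersurface.hypersurface F),
      g • x = diagonalMap F (pow_mem ha n) x := by
    intro g
    obtain ⟨n, hn⟩ := exists_pow_eq_of_mem_zpowers_deckUnit hp g.2
    exact ⟨n, fun x => by
      change diagonalMap F (hle g.2) x = _
      rw [diagonalMap_congr_of_eq F hn.symm (hle g.2) (pow_mem ha n)]⟩
  -- the projection
  obtain ⟨q, hq⟩ := exists_deckProjection hp hf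
  have hsurj : Function.Surjective q := deckProjection_surjective hp hf hq
  have horb : ∀ z z' : ComplexPoints (SmoothHypersurface.hypersurface F),
      q z = q z' ↔ ∃ g : ↥(Subgroup.zpowers (deckUnit p)), g • z = z' := by
    intro z z'
    constructor
    · intro h
      obtain ⟨n, hn⟩ := exists_diagonalMap_pow_eq_of_deckProjection_eq hp hf hq ha h
      exact ⟨⟨deckUnit p ^ n, pow_mem (Subgroup.mem_zpowers _) n⟩, hn⟩
    · rintro ⟨g, rfl⟩
      obtain ⟨n, hn⟩ := hact g
      rw [hn z, deckProjection_diagonalMap_pow hp hf hq ha n z]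
  -- the fixed locus: `{σ z = z}` = points over the branch curve `{x₃ = 0}`
  set σ : ↥(Subgroup.zpowers (deckUnit p)) := ⟨deckUnit p, Subgroup.mem_zpowers _⟩ with hσ
  set Fix : Set (ComplexPoints (SmoothHypersurface.hypersurface F)) := {z | σ • z = z} with hFix
  have hFc : IsClosed Fix := isClosed_eq (continuous_const_smul σ) continuous_id
  have hσact : ∀ z : ComplexPoints (SmoothHypersurface.hypersurface F), σ • z = diagonalMap F (pow_mem ha 1) z := by
    intro z
    change diagonalMap F (hle σ.2) z = _
    rw [diagonalMap_congr_of_eq F (pow_one (deckUnit p)).symm (hle σ.2) (pow_mem ha 1)]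
  have hmemFix : ∀ z : ComplexPoints (SmoothHypersurface.hypersurface F), z ∈ Fix ↔
      (hypersurfacePoint (SmoothHypersurface.hypersurfaceι F) z).rep (Fin.last 3) = 0 := by
    intro z
    rw [hFix, Set.mem_setOf_eq, hσact]
    constructor
    · intro h
      by_contra h3
      have h1 := deckUnit_pow_eq_one_of_diagonalMap_pow_eq_self f hp hf ha 1 z h3 h
      have hζ : Complex.exp (2 * (Real.pi : ℂ) * Complex.I / (p : ℂ)) = 1 := by
        have := congrArg (fun b : Fin 4 → ℂˣ => ((b (Fin.last 3) : ℂˣ) : ℂ)) h1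
        simp only [pow_one, Pi.one_apply, Units.val_one, val_deckUnit_apply_last] at this
        exact this
      exact (Complex.isPrimitiveRoot_exp p hp).ne_one (by omega) hζ
    · intro h
      exact diagonalMap_pow_eq_self_of_rep_last_eq_zero f ha 1 z h
  have hfix : ∀ z ∈ Fix, ∀ g : ↥(Subgroup.zpowers (deckUnit p)), g • z = z := by
    intro z hz g
    obtain ⟨n, hn⟩ := hact g
    rw [hn z]
    exact diagonalMap_pow_eq_self_of_rep_last_eq_zero f ha n z ((hmemFix z).mp hz)
  have hfree : ∀ z : ComplexPoints (SmoothHypersurface.hypersurface F), z ∉ Fix →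
      ∀ g : ↥(Subgroup.zpowers (deckUnit p)), g • z = z → g = 1 := by
    intro z hz g hg
    obtain ⟨m, hm⟩ := exists_pow_eq_of_mem_zpowers_deckUnit hp g.2
    have hg' : diagonalMap F (pow_mem ha m) z = z := by
      have e : g • z = diagonalMap F (pow_mem ha m) z := by
        change diagonalMap F (hle g.2) z = _
        rw [diagonalMap_congr_of_eq F hm.symm (hle g.2) (pow_mem ha m)]
      rw [← e]; exact hg
    have h1 := deckUnit_pow_eq_one_of_diagonalMap_pow_eq_self f hp hf ha m z
      (fun h => hz ((hmemFix z).mpr h)) hg'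
    exact Subtype.ext (hm.symm.trans h1)
  -- tautness of the fixed locus and of its image
  have hFl : LocallyContractibleSpace Fix := by
    -- `Fix` is the set of complex points over the Zariski-closed `X_F ∖ D₊(x₃)`
    letI : GradedAlgebra (MvPolynomial.homogeneousSubmodule (Fin 4) ℂ) := MvPolynomial.gradedAlgebra
    set Zcl : Set (SmoothHypersurface.hypersurface F).left :=
      (((SmoothHypersurface.hypersurfaceι F).left ⁻¹ᵁ
        (Proj.basicOpen (MvPolynomial.homogeneousSubmodule (Fin 4) ℂ) (MvPolynomial.X (Fin.last 3))) :
          TopologicalSpace.Opens _) : Set (SmoothHypersurface.hypersurface F).left)ᶜ with hZcl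
    have hZc : IsClosed Zcl := (TopologicalSpace.Opens.isOpen _).isClosed_compl
    have hmemZ : ∀ P : ComplexPoints (SmoothHypersurface.hypersurface F), P.pt ∈ Zcl ↔
        (hypersurfacePoint (SmoothHypersurface.hypersurfaceι F) P).rep (Fin.last 3) = 0 := by
      intro P
      have key := Set.ext_iff.mp (preimage_projPoint_setOf_pt_mem_basicOpen 3
        (MvPolynomial.X (Fin.last 3) : MvPolynomial (Fin 4) ℂ) 1 (MvPolynomial.isHomogeneous_X ℂ _))
        (hypersurfacePoint (SmoothHypersurface.hypersurfaceι F) P)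
      rw [Set.mem_preimage, Set.mem_setOf_eq, projPoint_hypersurfacePoint, AlgPoints.pt_map,
        Set.mem_compl_iff] at key
      have hmem : hypersurfacePoint (SmoothHypersurface.hypersurfaceι F) P ∈
          Projectivization.projZeroLocus {(MvPolynomial.X (Fin.last 3) : MvPolynomial (Fin 4) ℂ)} ↔
          (hypersurfacePoint (SmoothHypersurface.hypersurfaceι F) P).rep (Fin.last 3) = 0 := by
        change (∀ G ∈ ({MvPolynomial.X (Fin.last 3)} : Set (MvPolynomial (Fin 4) ℂ)),
          MvPolynomial.eval (hypersurfacePoint (SmoothHypersurface.hypersurfaceι F) P).rep G = 0) ↔ _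
        simp only [Set.mem_singleton_iff, forall_eq, MvPolynomial.eval_X]
      rw [← hmem, hZcl, Set.mem_compl_iff]
      change ¬ ((SmoothHypersurface.hypersurfaceι F).left (AlgPoints.pt P) ∈
        Proj.basicOpen (MvPolynomial.homogeneousSubmodule (Fin 4) ℂ) (MvPolynomial.X (Fin.last 3))) ↔ _
      rw [not_congr key, not_not]
    have hFixeq : Fix = {P | P.pt ∈ Zcl} := by
      ext P
      rw [hmemFix, Set.mem_setOf_eq, hmemZ]
    rw [hFixeq]
    exact locallyContractibleSpace_complexPoints
      (SmoothHypersurface.isProjectiveOver_hypersurface F).projectiveEmbedding hZc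
  obtain ⟨TF⟩ := nonempty_retractionNhds_of_isSmoothProjective hX hFc.isCompact hFl
  have hBl := OrbitMap.locallyContractibleSpace_image_of_fix q horb hFc hfix hFl
  obtain ⟨TB⟩ := nonempty_retractionNhds_of_isSmoothProjective hY (hFc.isCompact.image q.continuous) hBl
  -- the transfer
  obtain ⟨hinj, hsur⟩ := OrbitMap.transfer_of_semifree (R := ℚ) q horb hsurj hFc hfix hfree TF TB 2
  -- the invariants of `σ^*` are exactly the range of `q^*`
  set T := singularCohomology.map ℚ ℚ q 2 with hT
  have hrange : Module.End.eigenspace (BettiUniverse.pull (diagonalAut F ha) 2) 1 = LinearMap.range T.hom := by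
    apply le_antisymm
    · intro c hc
      rw [Module.End.mem_eigenspace_iff, one_smul] at hc
      have hc' : singularCohomology.map ℚ ℚ (diagonalMap F ha) 2 c = c := hc
      obtain ⟨d, hd⟩ := hsur c (fun g => by
        obtain ⟨n, hn⟩ := hact g
        have e : (⟨fun z ↦ g • z, continuous_const_smul g⟩ :
            C(ComplexPoints (SmoothHypersurface.hypersurface F), ComplexPoints (SmoothHypersurface.hypersurface F))) =
            diagonalMap F (pow_mem ha n) := ContinuousMap.ext fun z ↦ hn z
        rw [e]
        exact map_diagonalMap_pow_eq_self F ℚ ha n 2 hc')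
      exact ⟨d, hd⟩
    · rintro _ ⟨d, rfl⟩
      rw [Module.End.mem_eigenspace_iff, one_smul]
      change singularCohomology.map ℚ ℚ (diagonalMap F ha) 2 (singularCohomology.map ℚ ℚ q 2 d) =
        singularCohomology.map ℚ ℚ q 2 d
      rw [← ModuleCat.comp_apply, ← singularCohomology.map_comp]
      have hcomp : q.comp (diagonalMap F ha) = q := by
        refine ContinuousMap.ext fun z => ?_
        change q (diagonalMap F ha z) = q z
        rw [diagonalMap_congr_of_eq F (pow_one (deckUnit p)).symm ha (pow_mem ha 1)]
        exact deckProjection_diagonalMap_pow hp hf hq ha 1 z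
      rw [hcomp]
  rw [hrange, LinearMap.finrank_range_of_inj]
  · exact finrank_bettiCohomology_projectiveSpace_two_mul 2 (p := 1) (by norm_num)
  · intro d d' h
    exact hinj h

end InvariantLine

end HodgeTheory

end Literature.AlgebraicGeometry.HodgeTheory

end
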